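import Mathlib
import Literature.NumberTheory.Automorphic.GaussCellGL

/-!
# Generic translation into the big cell — stub `stub_exists_translate_leadMinor_ne_zero` of
line `Sketch` (crux `GLnSeparatingDesigns.BorderHalfDimensionDesigns`,
stmt-MatrixMultiplication-18360)

For finitely many `y ∈ GL_n(ℂ)` there is ONE `g ∈ GL_n(ℂ)` such that every `y⁻¹ g` lies in
the big cell `U⁻ T U`, i.e. all leading principal minors `Δ_j(y⁻¹ g)` (`j = 0, …, n - 1`;
`Literature.NumberTheory.Automorphic.leadMinor Fin.castSucc · (Fin.castSucc j)`, the determinant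
of the `{i < j} × {i < j}` block) are non-zero. Proof: in the generic matrix
`X = Matrix.mvPolynomialX` the polynomial `P = ∏_{y ∈ Y} ∏_j Δ_j(y⁻¹ X)` is non-zero (each
factor evaluates to `Δ_j(y⁻¹ y) = Δ_j(1) = 1` at `X = y`, and `ℂ[X]` is a domain), so by
Zariski density of `GL_n(ℂ)` in `M_n(ℂ)` over the infinite field `ℂ`
(Mathlib `MvPolynomial.eq_of_eval_eq_on_gl`) it does not vanish at some invertible `g`; the
factors of `P(g) ≠ 0` are the `Δ_j(y⁻¹ g)` (`leadMinor_map`). Springer, *Linear Algebraic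
Groups*, 8.3.11 (the big cell is open and dense); Borel IV.14.14.
-/

-- `Summit.MatrixMultiplication.MatrixMultiplication.…` is the tree's mandated summit-side
-- namespace (Sub = Summit), flagged by `dupNamespace`.
set_option linter.dupNamespace false

open scoped MatrixGroups

namespace Summit.MatrixMultiplication.MatrixMultiplication.Theorems.BorderHalfDimensionDesigns

open Literature.NumberTheory.Automorphic (leadMinor leadMinor_one leadMinor_map)

/-- Evaluating the matrix `A · X` (`A` constant, `X` the generic matrix) at the entries of `g`
gives `A · g`. [folklore] -/
private theorem map_eval_const_mul_mvPolynomialX {n : ℕ} (A g : Matrix (Fin n) (Fin n) ℂ) :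
    (A.map MvPolynomial.C * Matrix.mvPolynomialX (Fin n) (Fin n) ℂ).map
        (MvPolynomial.eval fun ij : Fin n × Fin n => g ij.1 ij.2) = A * g := by
  rw [Matrix.map_mul]
  congr 1
  · ext i j
    simp
  · ext i j
    simp

/-- The factor `Δ_j(y⁻¹ X)` of the test polynomial evaluates at `g ∈ GL_n` to
`Δ_j(y⁻¹ g)`. [folklore] -/
private theorem eval_leadMinor_inv_mul_mvPolynomialX {n : ℕ} (g y : GL (Fin n) ℂ) (j : Fin n) :
    MvPolynomial.eval (fun ij : Fin n × Fin n => (g : Matrix (Fin n) (Fin n) ℂ) ij.1 ij.2)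
        (leadMinor Fin.castSucc
          (((y⁻¹ : GL (Fin n) ℂ) : Matrix (Fin n) (Fin n) ℂ).map MvPolynomial.C *
            Matrix.mvPolynomialX (Fin n) (Fin n) ℂ) (Fin.castSucc j)) =
      leadMinor Fin.castSucc ((y⁻¹ * g : GL (Fin n) ℂ) : Matrix (Fin n) (Fin n) ℂ)
        (Fin.castSucc j) := by
  rw [← leadMinor_map, map_eval_const_mul_mvPolynomialX, Units.val_mul]

/-- **Generic translation into the big cell.** For a finite set `Y ⊆ GL_n(ℂ)` there is
`g ∈ GL_n(ℂ)` with all leading principal minors `Δ_j(y⁻¹ g)`, `j < n`, non-zero for every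
`y ∈ Y`: the polynomial `∏_{y ∈ Y} ∏_j Δ_j(y⁻¹ X)` in the generic matrix `X` is non-zero (its
factors are `1` at `X = y`) and `GL_n(ℂ)` is Zariski dense in `M_n(ℂ)`
(`MvPolynomial.eq_of_eval_eq_on_gl`). Springer 8.3.11; Borel IV.14.14. [folklore] -/
theorem stub_exists_translate_leadMinor_ne_zero {n : ℕ} (Y : Finset (Matrix.GeneralLinearGroup (Fin n) ℂ)) :
    ∃ g : Matrix.GeneralLinearGroup (Fin n) ℂ, ∀ y ∈ Y, ∀ j : Fin n,
      Literature.NumberTheory.Automorphic.leadMinor Fin.castSucc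
        ((y⁻¹ * g : Matrix.GeneralLinearGroup (Fin n) ℂ) : Matrix (Fin n) (Fin n) ℂ) (Fin.castSucc j) ≠ 0 := by
  classical
  -- the test polynomial `P = ∏_{y ∈ Y} ∏_j Δ_j(y⁻¹ X)` in the entries of the generic
  -- matrix `X`
  set P : MvPolynomial (Fin n × Fin n) ℂ := ∏ y ∈ Y, ∏ j : Fin n,
    leadMinor Fin.castSucc
      (((y⁻¹ : GL (Fin n) ℂ) : Matrix (Fin n) (Fin n) ℂ).map MvPolynomial.C *
        Matrix.mvPolynomialX (Fin n) (Fin n) ℂ) (Fin.castSucc j) with hP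
  -- `P ≠ 0`: the factor `Δ_j(y⁻¹ X)` is `Δ_j(1) = 1` at `X = y`
  have hP0 : P ≠ 0 := by
    rw [hP]
    refine Finset.prod_ne_zero_iff.mpr fun y _ => Finset.prod_ne_zero_iff.mpr fun j _ h0 => ?_
    have h1 := congrArg (MvPolynomial.eval fun ij : Fin n × Fin n =>
      ((y : GL (Fin n) ℂ) : Matrix (Fin n) (Fin n) ℂ) ij.1 ij.2) h0
    rw [eval_leadMinor_inv_mul_mvPolynomialX, inv_mul_cancel, Units.val_one, leadMinor_one,
      map_zero] at h1
    exact one_ne_zero h1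
  -- hence `P(g) ≠ 0` for some invertible `g` (density of `GL_n` over the infinite field `ℂ`)
  by_contra hne
  push Not at hne
  refine hP0 (MvPolynomial.eq_of_eval_eq_on_gl fun g => ?_)
  obtain ⟨y, hy, j, hj⟩ := hne g
  rw [map_zero, hP, map_prod]
  refine Finset.prod_eq_zero hy ?_
  rw [map_prod]
  refine Finset.prod_eq_zero (Finset.mem_univ j) ?_
  rw [eval_leadMinor_inv_mul_mvPolynomialX]
  exact hj

end Summit.MatrixMultiplication.MatrixMultiplication.Theorems.BorderHalfDimensionDesigns
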